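import Summits.Langlands.Langlands.Theorems.PhantomRMYoshidaStableYoshidaCongruenceIrrCloses

/-!
# Crux `StableYoshidaCongruence` (stmt-Langlands-13640) — negative knowledge: the crux is refuted by any
# RIGID PAIR, and (given the route's own target) only by a rigid pair

Negative-lemma file (`--negative-modulo RigidPair`, `--supports stmt-Langlands-13640`; line lead c18,
2026-08-17).  It does NOT refute the crux and asserts no statement of the route.  It moves to the
Theorems layer, stated against the ROUTE DECLARATIONS BY NAME, the standing disprover's analysis
(`Cruxes/StableYoshidaCongruence/Disproof.lean` §3.3–§3.4, §6 "what a kill needs") and the strategist's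
split (`Cruxes/StableYoshidaCongruence/SPLIT.md`, certificates landed in
`Theorems/PhantomRMYoshidaStableYoshidaCongruenceIrrCloses.lean`):

* `RigidPair` (the hypothesis `H` of this negative lemma): some odd prime `p` and some pair
  `(σ̄, σ̄')` satisfy EVERY hypothesis of the crux — residually automorphic on `GL₂`, irreducible,
  `det = ε̄⁻¹`, non-conjugate, and possessing SOME lift `ρ` of the crux's shape `Sh` (symplectic-`ε⁻¹`,
  Greenberg-ordinary of shape `(0,0,1,1)` and residually distinguished at `p`, a.e. Frobenius polynomial
  reducing to `charpoly σ̄ · charpoly σ̄'`) — while NO lift of shape `Sh` is irreducible, at any level.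
* `StableYoshidaCongruence_false_of_RigidPair` — a rigid pair refutes the crux, with no automorphic
  input (the crux's conclusion hands back an irreducible `Sh`-lift).
* `rigidPair_iff_not_irregularSymplecticLifting` — `RigidPair` is EXACTLY the negation of the proposed
  child₂ `IrregularSymplecticLifting` of SPLIT.md (the Galois-side reducible-witness surplus of the crux,
  which the route's deciding theorem does not consume: `langlands_of_stableYoshidaCongruenceIrr`).
* `rigidPair_of_not_stableYoshidaCongruence` / `not_stableYoshidaCongruence_iff_rigidPair` — modulo the
  route's own target `PhantomRMSector`, a refutation of the crux IS a rigid pair: any disproof compatible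
  with conjunct (B) of the summit must exhibit one.

STATUS OF `H` (read before acting on the construction item the gate files for it): the existence of a
rigid pair is OPEN.  It is an irregular-weight NON-LIFTING theorem for `GSp₄/ℚ` (Hodge–Tate type
`(0,0,1,1)`): the relevant Siegel-ordinary symplectic deformation problem has expected dimension
`3 - 4 = -1` (Disproof §6), so irreducible `Sh`-lifts are unclassified "accidents" (abelian surfaces,
functorial constructions); on the generic regime (p ≥ 5, large image; twisted moduli `A₂(ρ̄)` of general
type) neither a construction nor an obstruction is in print (Fakhruddin–Khare–Patrikis arXiv:2202.00405;
Deo–Palvannan arXiv:2602.20737; Cruxes/…/BarrierNotesR2Seat5.md B5).  Nobody can construct `H` today and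
nobody can refute it; this file only pins down that `H`, and (given the target) nothing weaker, kills
the crux as filed — the irreducible-witness form `StableYoshidaCongruenceIrr` (SPLIT.md child₁) is
untouched by any rigid pair.  Pure logic over the two inhabitation facts already used by the IrrCloses
certificates. [folklore]
-/

set_option linter.dupNamespace false -- project-wide option (lakefile weak.linter.dupNamespace); `Summit.Langlands.Langlands` is the mandated namespace (D-0017)

namespace Summit.Langlands.Langlands.Theorems.StableYoshidaCongruence.Negative

open Summit.Langlands.Langlands.Theses.PhantomRMYoshida
open Summit.Langlands.Langlands.Theorems.PhantomRMYoshida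
open Literature.NumberTheory.GaloisRepresentations Literature.NumberTheory.Automorphic

/-- **`RigidPair`** — the hypothesis `H` of this negative lemma.  Some odd prime `p`, coefficient
field `k` with reduction map `red : 𝒪_{ℚ̄_p} → k`, and pair `σ σ' : Γ_ℚ → GL₂(k)` satisfy ALL the
hypotheses of crux `StableYoshidaCongruence` at that datum (spelled byte-identically to the route file:
`AutGL2 σ`, `AutGL2 σ'`, irreducibility, `det σ = ε̄⁻¹ = det σ'`, non-conjugacy, `∃ ρ, Sh ρ`) and in
addition every `ρ₁ : Γ_ℚ → GL₄(ℚ̄_p)` of shape `Sh` is REDUCIBLE.  Equivalently (below,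
`rigidPair_iff_not_irregularSymplecticLifting`) the negation of SPLIT.md's child₂.  Existence OPEN
(an expected-dimension `-1` non-lifting statement for `GSp₄/ℚ`; Disproof.lean §3.4, §6): no instance is
known or refuted.  HYPOTHESIS of this negative lemma (filed `--negative-modulo RigidPair`); unproved and
not in print, hence deliberately NOT a cited Literature fact. -/
def RigidPair : Prop :=
  ∃ (p : ℕ) (_ : Fact p.Prime), p ≠ 2 ∧ ∃ (k : Type) (_ : Field k) (_ : CharP k p) (_ : IsAlgClosed k) (_ : TopologicalSpace k) (_ : DiscreteTopology k) (red : Valued.integer (PadicAlgCl p) →+* k) (σ σ' : Literature.NumberTheory.GaloisRepresentations.FramedGaloisRep ℚ k 2), let εb : Field.absoluteGaloisGroup ℚ →* (ZMod p)ˣ := (modularCyclotomicCharacter (AlgebraicClosure ℚ) (HasEnoughRootsOfUnity.natCard_rootsOfUnity (AlgebraicClosure ℚ) p)).comp (MulSemiringAction.toRingAut (Field.absoluteGaloisGroup ℚ) (AlgebraicClosure ℚ)); let Sh := fun r : Literature.NumberTheory.GaloisRepresentations.FramedGaloisRep ℚ (PadicAlgCl p) 4 => (r.IsSymplecticWithMultiplierFun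 (fun g => algebraMap ℚ_[p] (PadicAlgCl p) ((((Literature.NumberTheory.GaloisRepresentations.GaloisRep.cyclotomicCharacter ℚ p g)⁻¹ : ℤ_[p]ˣ) : ℤ_[p]) : ℚ_[p])) ∧ (∀ v : IsDedekindDomain.HeightOneSpectrum (NumberField.RingOfIntegers ℚ), ((p : ℕ) : NumberField.RingOfIntegers ℚ) ∈ v.asIdeal → r.IsGreenbergOrdinaryOfShapeAt v ![0, 0, 1, 1] ∧ r.IsResiduallyDistinguishedAt v ![0, 0, 1, 1]) ∧ (∀ᶠ v : IsDedekindDomain.HeightOneSpectrum (NumberField.RingOfIntegers ℚ) in Filter.cofinite, r.IsUnramifiedAt v ∧ σ.IsUnramifiedAt v ∧ σ'.IsUnramifiedAt v ∧ ∃ (P : Polynomial (Valued.integer (PadicAlgCl p))) (P₁ P₂ : Polynomial k), r.HasFrobCharpolyAt v (P.map (Valued.integer (PadicAlgCl p)).subtype) ∧ σ.HasFrobCharpolyAt v P₁ ∧ σ'.HasFrobCharpolyAt v P₂ ∧ P.map red = P₁ * P₂)); let AutGL2 := fun s : Literature.NumberTheory.GaloisRepresentations.FramedGaloisRep ℚ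 k 2 => (∀ (hcpt₂ : Literature.NumberTheory.Automorphic.isCompact_glFiniteIntegralLevel 2 ℚ) (ι : PadicAlgCl p ≃+* ℂ), ∃ π₂ : Literature.NumberTheory.Automorphic.CuspidalAutomorphicRepData 2 ℚ hcpt₂, π₂.1.IsLAlgebraic ∧ ∀ᶠ v : IsDedekindDomain.HeightOneSpectrum (NumberField.RingOfIntegers ℚ) in Filter.cofinite, ∃ (a : Multiset ℂ) (P : Polynomial (Valued.integer (PadicAlgCl p))) (Pb : Polynomial k), π₂.1.HasSatakeParamAt v a ∧ P.map (Valued.integer (PadicAlgCl p)).subtype = Literature.NumberTheory.Automorphic.arithFrobPolyOfSatake ι v.residueCard 1 a ∧ s.IsUnramifiedAt v ∧ s.HasFrobCharpolyAt v Pb ∧ P.map red = Pb); AutGL2 σ ∧ AutGL2 σ' ∧ σ.toGaloisRep.IsIrreducible ∧ σ'.toGaloisRep.IsIrreducible ∧ (∀ g, Literature.NumberTheory.GaloisRepresentations.FramedRep.det σ g = (Units.map (ZMod.castHom (dvd_refl p) k).toMonoidHom (εb g))⁻¹ ∧ Literature.NumberTheory.GaloisRepresentations.FramedRep.det σ' g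 = Literature.NumberTheory.GaloisRepresentations.FramedRep.det σ g) ∧ (¬ ∃ g : GL (Fin 2) k, ∀ x, g * σ x * g⁻¹ = σ' x) ∧ (∃ ρ : Literature.NumberTheory.GaloisRepresentations.FramedGaloisRep ℚ (PadicAlgCl p) 4, Sh ρ) ∧ ∀ ρ₁ : Literature.NumberTheory.GaloisRepresentations.FramedGaloisRep ℚ (PadicAlgCl p) 4, Sh ρ₁ → ¬ ρ₁.toGaloisRep.IsIrreducible

/-- **Negative lemma: a rigid pair refutes the crux.**  At the rigid datum the crux's conclusion,
instantiated at the inhabited binders `hcpt`, `ι` (`stableYoshidaCongruence_imp_lifting`), returns an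
irreducible lift of shape `Sh`, which the rigid pair forbids.  No automorphic input is used. [folklore] -/
theorem StableYoshidaCongruence_false_of_RigidPair : RigidPair → ¬ StableYoshidaCongruence := by
  rintro ⟨p, hp, hp2, k, _, _, _, _, _, red, σ, σ', h₁, h₂, h₃, h₄, h₅, h₆, hw, hno⟩ hS
  obtain ⟨ρ₁, hirr, hSh⟩ :=
    stableYoshidaCongruence_imp_lifting hS p hp2 k red σ σ' h₁ h₂ h₃ h₄ h₅ h₆ hw
  exact hno ρ₁ hSh hirr

/-- **`RigidPair` is exactly the negation of child₂ `IrregularSymplecticLifting`** (SPLIT.md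
children.json[1], spelled verbatim): "every eligible pair with some `Sh`-lift has an irreducible one".
So the construction item filed for `H` and a refutation of child₂ are the same task. [folklore] -/
theorem rigidPair_iff_not_irregularSymplecticLifting :
    RigidPair ↔ ¬ (∀ (p : ℕ) [Fact p.Prime], p ≠ 2 → ∀ (k : Type) [Field k] [CharP k p] [IsAlgClosed k] [TopologicalSpace k] [DiscreteTopology k] (red : Valued.integer (PadicAlgCl p) →+* k) (σ σ' : Literature.NumberTheory.GaloisRepresentations.FramedGaloisRep ℚ k 2), let εb : Field.absoluteGaloisGroup ℚ →* (ZMod p)ˣ := (modularCyclotomicCharacter (AlgebraicClosure ℚ) (HasEnoughRootsOfUnity.natCard_rootsOfUnity (AlgebraicClosure ℚ) p)).comp (MulSemiringAction.toRingAut (Field.absoluteGaloisGroup ℚ) (AlgebraicClosure ℚ)); let Sh := fun r : Literature.NumberTheory.GaloisRepresentations.FramedGaloisRep ℚ (PadicAlgCl p) 4 => (r.IsSymplecticWithMultiplierFun (fun g => algebraMap ℚ_[p] (PadicAlgCl p) ((((Literature.NumberTheory.GaloisRepresentations.GaloisRep.cyclotomicCharacter ℚ p g)⁻¹ : ℤ_[p]ˣ)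 : ℤ_[p]) : ℚ_[p])) ∧ (∀ v : IsDedekindDomain.HeightOneSpectrum (NumberField.RingOfIntegers ℚ), ((p : ℕ) : NumberField.RingOfIntegers ℚ) ∈ v.asIdeal → r.IsGreenbergOrdinaryOfShapeAt v ![0, 0, 1, 1] ∧ r.IsResiduallyDistinguishedAt v ![0, 0, 1, 1]) ∧ (∀ᶠ v : IsDedekindDomain.HeightOneSpectrum (NumberField.RingOfIntegers ℚ) in Filter.cofinite, r.IsUnramifiedAt v ∧ σ.IsUnramifiedAt v ∧ σ'.IsUnramifiedAt v ∧ ∃ (P : Polynomial (Valued.integer (PadicAlgCl p))) (P₁ P₂ : Polynomial k), r.HasFrobCharpolyAt v (P.map (Valued.integer (PadicAlgCl p)).subtype) ∧ σ.HasFrobCharpolyAt v P₁ ∧ σ'.HasFrobCharpolyAt v P₂ ∧ P.map red = P₁ * P₂)); let AutGL2 := fun s : Literature.NumberTheory.GaloisRepresentations.FramedGaloisRep ℚ k 2 => (∀ (hcpt₂ : Literature.NumberTheory.Automorphic.isCompact_glFiniteIntegralLevel 2 ℚ) (ι : PadicAlgCl p ≃+* ℂ), ∃ π₂ : Literature.NumberTheory.Automorphic.CuspidalAutomorphicRepData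 2 ℚ hcpt₂, π₂.1.IsLAlgebraic ∧ ∀ᶠ v : IsDedekindDomain.HeightOneSpectrum (NumberField.RingOfIntegers ℚ) in Filter.cofinite, ∃ (a : Multiset ℂ) (P : Polynomial (Valued.integer (PadicAlgCl p))) (Pb : Polynomial k), π₂.1.HasSatakeParamAt v a ∧ P.map (Valued.integer (PadicAlgCl p)).subtype = Literature.NumberTheory.Automorphic.arithFrobPolyOfSatake ι v.residueCard 1 a ∧ s.IsUnramifiedAt v ∧ s.HasFrobCharpolyAt v Pb ∧ P.map red = Pb); AutGL2 σ → AutGL2 σ' → σ.toGaloisRep.IsIrreducible → σ'.toGaloisRep.IsIrreducible → (∀ g, Literature.NumberTheory.GaloisRepresentations.FramedRep.det σ g = (Units.map (ZMod.castHom (dvd_refl p) k).toMonoidHom (εb g))⁻¹ ∧ Literature.NumberTheory.GaloisRepresentations.FramedRep.det σ' g = Literature.NumberTheory.GaloisRepresentations.FramedRep.det σ g) → (¬ ∃ g : GL (Fin 2) k, ∀ x, g * σ x * g⁻¹ = σ' x) → (∃ ρ : Literature.NumberTheory.GaloisRepresentations.FramedGaloisRep ℚ (PadicAlgCl p) 4,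 Sh ρ) → ∃ ρ₁ : Literature.NumberTheory.GaloisRepresentations.FramedGaloisRep ℚ (PadicAlgCl p) 4, ρ₁.toGaloisRep.IsIrreducible ∧ Sh ρ₁) := by
  constructor
  · rintro ⟨p, hp, hp2, k, _, _, _, _, _, red, σ, σ', h₁, h₂, h₃, h₄, h₅, h₆, hw, hno⟩ hL
    obtain ⟨ρ₁, hirr, hSh⟩ := hL p hp2 k red σ σ' h₁ h₂ h₃ h₄ h₅ h₆ hw
    exact hno ρ₁ hSh hirr
  · intro h
    by_contra hR
    apply h
    intro p iP hp k iF iC iA iT iD red σ σ' εb Sh AutGL2 h₁ h₂ h₃ h₄ h₅ h₆ hw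
    by_contra hno
    push Not at hno
    exact hR ⟨p, iP, hp, k, iF, iC, iA, iT, iD, red, σ, σ', h₁, h₂, h₃, h₄, h₅, h₆, hw,
      fun ρ₁ hSh hirr => hno ρ₁ hirr hSh⟩

/-- **Modulo the route's own target, a refutation of the crux IS a rigid pair.**  If `PhantomRMSector`
holds (every irreducible `Sh`-lift is automorphic) and the crux fails, then some eligible datum has a
`Sh`-witness but no irreducible `Sh`-lift: otherwise the irreducible lift, automorphic by the target
(oddness being free, `isOdd_of_det_eq_inv_epsBar`), would verify the crux there.  Hence a disproof of the
crux compatible with conjunct (B) of the summit must exhibit a rigid pair. [folklore] -/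
theorem rigidPair_of_not_stableYoshidaCongruence (hX : PhantomRMSector)
    (h : ¬ StableYoshidaCongruence) : RigidPair := by
  by_contra hR
  apply h
  intro p iP hp k iF iC iA iT iD red σ σ' εb Sh AutGL2 h₁ h₂ h₃ h₄ h₅ h₆ hw hcpt ι
  have hex : ∃ ρ₁ : Literature.NumberTheory.GaloisRepresentations.FramedGaloisRep ℚ (PadicAlgCl p) 4,
      ρ₁.toGaloisRep.IsIrreducible ∧ Sh ρ₁ := by
    by_contra hno
    push Not at hno
    exact hR ⟨p, iP, hp, k, iF, iC, iA, iT, iD, red, σ, σ', h₁, h₂, h₃, h₄, h₅, h₆, hw,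
      fun ρ₁ hSh hirr => hno ρ₁ hirr hSh⟩
  obtain ⟨ρ₁, hirr, hSh⟩ := hex
  have hodd := isOdd_of_det_eq_inv_epsBar h₅
  exact ⟨ρ₁, hirr, hSh, hX p hp k red σ σ' hcpt ι ρ₁ hodd.1 hodd.2 h₃ h₄ h₅ h₆ hirr hSh⟩

/-- **Given the target, `¬ crux ↔ RigidPair`.**  The crux as filed = child₁ `StableYoshidaCongruenceIrr`
(what `closes` consumes; a corollary of the target) ∧ child₂ (`stableYoshidaCongruence_iff_irr_and_lifting`);
under the target only child₂ can fail, and its failure is a rigid pair. [folklore] -/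
theorem not_stableYoshidaCongruence_iff_rigidPair (hX : PhantomRMSector) :
    ¬ StableYoshidaCongruence ↔ RigidPair :=
  ⟨rigidPair_of_not_stableYoshidaCongruence hX, StableYoshidaCongruence_false_of_RigidPair⟩

end Summit.Langlands.Langlands.Theorems.StableYoshidaCongruence.Negative
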